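import Summits.BirchSwinnertonDyer.Rank1Residual.P2.CornerFTwoModelLocalTwo
import HarnessLib

/-!
# Leaf CornerF @ `p = 2` — THE MODEL ATLAS, file 8 (cell `bsd-print-cf2`, D-0131 (2) print tier,
# typer ty2): the INERT-GOOD / INERT-BAD cells of the two inert layer-2 cruxes IN MODEL CURRENCY

HONEST FRAMING (cell `bsd-print-cf2`, HOME `run/shared/lean/pub/bsd-print-cf2/`, verbatim in every
file): the partition leaf is `CornerF W 2` — `W/ℚ` globally minimal elliptic WITH CM and
`ord_{s=1} L(E,s) = 1`, at the prime `2` (rung leaf `WAllCornerFTwo`; OPEN AS A CLASS). Nothing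
class-wide is closed here. Route `PrintCf2` rev 5 (planner g2, 2026-08-27T15:39Z) registered, on the
inert children stmt-BirchSwinnertonDyer-20671 `InertJZeroOfFacts` (`j = 0`) and
stmt-BirchSwinnertonDyer-20672 `InertOddHeegnerJOfFacts` (the five odd-Heegner `j`), the birth stubs
`stub_inertJZero_goodAtTwo` / `stub_inertJZero_badAtTwo` and `stub_inertOddHeegner_goodAtTwo` /
`stub_inertOddHeegner_badAtTwo`: the child statement with `Good W 2` resp. `¬ Good W 2` inserted before
`BSDp W 2` — the cut by REDUCTION TYPE AT `2`, i.e. the PARTITION cells INERT-GOOD / INERT-BAD. File 6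
(`CornerFTwoModelInertJ`) rewrote the two children through the atlas WITHOUT the cut
(`jZero_iff_sextics`, `oddHeegnerJ_iff_twists`); THIS FILE adds the cut, as exact arithmetic on the
model parameters (local lemmas: file 7, `CornerFTwoModelLocalTwo`), fact-free:

* **odd Heegner fields** (`cm11 = 121b1`, `cm19 = 361a1`, `cm43`, `cm67`, `cm163`; all good at `2`,
  conductor `p²`): a globally minimal model of the square-free twist `E₀^{(d)}` is GOOD at `2` iff
  `d ≡ 1 (mod 4)`, BAD (additive) iff `d ≡ 2, 3 (mod 4)` — `oddHeegnerJ_good_iff_twists` (consequent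
  of `stub_inertOddHeegner_goodAtTwo` ⟺ five twist families with `d % 4 = 1`),
  `oddHeegnerJ_bad_iff_twists` (`… badAtTwo` ⟺ `d % 4 ≠ 1`); the one-`j` forms `jEq_good_iff_twists` /
  `jEq_bad_iff_twists` hold for ANY base good at `2` with `j ≠ 0, 1728` (e.g. p3's Kriz–Li base
  `243a1`: its twists by `d ≡ 1 (mod 4)` are INERT-GOOD, by `d ≡ 2, 3 (mod 4)` INERT-BAD);
* **`j = 0`** (`y² = x³ + B`, `B ∈ ℤ∖{0}`, `2⁶ ∤ B`): `jZero_good_iff_sextics` (consequent of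
  `stub_inertJZero_goodAtTwo` ⟺ the sextics with `B ≡ 16 (mod 64)`), `jZero_good_iff_cubicA₃Models`
  (⟺ the `ℚ`-models of `y² + y = x³ + a`, `a ∈ ℤ` — Cremona's shape of `27a1 = ⟨0,0,1,0,−7⟩`, `27a3`,
  `243a1 = ⟨0,0,1,0,−1⟩`), `jZero_bad_iff_sextics` (`… badAtTwo` ⟺ the reduced sextics with
  `B ≢ 16 (mod 64)`: `36a1 = (B = 1)` and its Shu–Zhai twist family, the even cube sums, …).

No theorem in print at `2` covers any of these cells as a class (DOSSIER §14.5); the cells are the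
tribunal wording of the residuals in PARTITION currency. Fact-free: NO arithmetic fact, NO definition,
NO named fact (D-0026); `beyond-print: NO` (interface).

References: [BarriosEtAl2025] Thm. 5.1 (arXiv:2501.03209 pp. 15–16); [SilvermanAEC2009] VII.5 Prop.
5.1(a), X.5 Prop. 5.4 / Cor. 5.4.1; [SilvermanATAEC1994] App. A §3; [KrizLi2019] Thm. 1.12, §6 Table 1;
HOME/STATUS planner 15:39:04Z (rev 5 births); `P2/CornerFTwoModelInertJ.lean`, `P2/CornerFTwoModelLocalTwo.lean`.
-/

noncomputable section

open scoped Classical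

open WeierstrassCurve Literature.NumberTheory.EllipticCurves
  Literature.NumberTheory.EllipticCurves.Rank1Residual IsDedekindDomain NumberField Rat.HeightOneSpectrum

set_option autoImplicit false

namespace Summit.BirchSwinnertonDyer.Rank1Residual.P2.CornerFTwo

open Atlas

/-! ## §1 The five odd Heegner fields (item 20672): INERT-GOOD = `d ≡ 1 (mod 4)`, INERT-BAD = `d ≡ 2, 3 (mod 4)` -/

/-- **One `j ∉ {0, 1728}`, GOOD cell, in model currency.** For a base `E/ℚ` with `j(E) ≠ 0, 1728`
and good reduction at `2`: "`BSD(W,2)` for every globally minimal `W` of analytic rank one with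
`j(W) = j(E)` and GOOD reduction at `2`" ⟺ "for every square-free `d ∈ ℤ∖{0}` with `d ≡ 1 (mod 4)`,
`BSD(W,2)` for every globally minimal model `W` of analytic rank one of `E^{(d)}`".
[cite: SilvermanAEC2009, X.5 Prop. 5.4 and Cor. 5.4.1]
[cite: BarriosEtAl2025, Thm. 5.1 with the rows R = I₀ of the §5 tables (arXiv:2501.03209 pp. 15–16)] -/
theorem jEq_good_iff_twists (E : WeierstrassCurve ℚ) [E.IsElliptic] (h0 : E.j ≠ 0)
    (h1728 : E.j ≠ 1728) (hE : E.HasGoodReductionAtPrime 2) :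
    (∀ (W : WeierstrassCurve ℚ) [W.IsElliptic] [W.IsGloballyMinimal],
        W.analyticRank = 1 → W.j = E.j → Good W 2 → BSDp W 2) ↔
      (∀ d : ℤ, d ≠ 0 → Squarefree d → d % 4 = 1 →
        ∀ (W : WeierstrassCurve ℚ) [W.IsElliptic] [W.IsGloballyMinimal],
          (∃ C : VariableChange ℚ, C • E.quadraticTwist (d : ℚ) = W) →
          W.analyticRank = 1 → BSDp W 2) := by
  constructor
  · intro h d hd hsq h4 W _ _ hW hr
    obtain ⟨C, hC⟩ := hW
    have hd' : (d : ℚ) ≠ 0 := by exact_mod_cast hd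
    exact h W hr (j_eq_of_smul_twist hd' hC)
      ((good_two_iff_of_smul_quadraticTwist_of_squarefree E W hE hsq hC).mpr h4)
  · intro h W _ _ hr hj hgood
    obtain ⟨d, hd, hsq, C, hC⟩ := exists_smul_twist_of_j_eq hj h0 h1728
    exact h d hd hsq ((good_two_iff_of_smul_quadraticTwist_of_squarefree E W hE hsq hC).mp hgood)
      W ⟨C, hC⟩ hr

/-- **One `j ∉ {0, 1728}`, BAD cell, in model currency**: the same with `¬ Good W 2` on the left and
`d % 4 ≠ 1` (i.e. `d ≡ 2, 3 (mod 4)`: `2` ramifies in `ℚ(√d)`, the twist is additive at `2`) on the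
right. [cite: SilvermanAEC2009, X.5 Prop. 5.4 and Cor. 5.4.1]
[cite: BarriosEtAl2025, Thm. 5.1 with the rows R = I₀ of the §5 tables (arXiv:2501.03209 pp. 15–16)] -/
theorem jEq_bad_iff_twists (E : WeierstrassCurve ℚ) [E.IsElliptic] (h0 : E.j ≠ 0)
    (h1728 : E.j ≠ 1728) (hE : E.HasGoodReductionAtPrime 2) :
    (∀ (W : WeierstrassCurve ℚ) [W.IsElliptic] [W.IsGloballyMinimal],
        W.analyticRank = 1 → W.j = E.j → ¬ Good W 2 → BSDp W 2) ↔
      (∀ d : ℤ, d ≠ 0 → Squarefree d → d % 4 ≠ 1 →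
        ∀ (W : WeierstrassCurve ℚ) [W.IsElliptic] [W.IsGloballyMinimal],
          (∃ C : VariableChange ℚ, C • E.quadraticTwist (d : ℚ) = W) →
          W.analyticRank = 1 → BSDp W 2) := by
  constructor
  · intro h d hd hsq h4 W _ _ hW hr
    obtain ⟨C, hC⟩ := hW
    have hd' : (d : ℚ) ≠ 0 := by exact_mod_cast hd
    exact h W hr (j_eq_of_smul_twist hd' hC)
      (fun hg => h4 ((good_two_iff_of_smul_quadraticTwist_of_squarefree E W hE hsq hC).mp hg))
  · intro h W _ _ hr hj hbad
    obtain ⟨d, hd, hsq, C, hC⟩ := exists_smul_twist_of_j_eq hj h0 h1728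
    exact h d hd hsq
      (fun h4 => hbad ((good_two_iff_of_smul_quadraticTwist_of_squarefree E W hE hsq hC).mpr h4))
      W ⟨C, hC⟩ hr

/-- **THE FIVE ODD HEEGNER FIELDS, CELL INERT-GOOD, IN MODEL CURRENCY** — the consequent of the
registered stub `stub_inertOddHeegner_goodAtTwo` of item stmt-BirchSwinnertonDyer-20672
(`𝔅_inert → ∀ W, r_an = 1 → j(W) ∈ {five} → Good W 2 → BSD(W,2)`) ⟺ the conjunction over the five
bases `cm11 = 121b1`, `cm19 = 361a1`, `cm43 = 1849a1`, `cm67 = 4489a1`, `cm163 = 26569a1` (all good at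
`2`: conductors `p²`, `p` odd) of "`BSD(W,2)` for every globally minimal model of analytic rank one of a
twist of the base by a square-free `d ≡ 1 (mod 4)`". Nothing in print at `2` on any of the five
(DOSSIER §14.5: Kriz–Li Thm. 5.1 (2) has no usable (★)-base of conductor `< 5000` here).
[cite: SilvermanAEC2009, X.5 Prop. 5.4 and Cor. 5.4.1] [cite: SilvermanATAEC1994, App. A §3]
[cite: BarriosEtAl2025, Thm. 5.1 with the rows R = I₀ of the §5 tables (arXiv:2501.03209 pp. 15–16)] -/
theorem oddHeegnerJ_good_iff_twists :
    (∀ (W : WeierstrassCurve ℚ) [W.IsElliptic] [W.IsGloballyMinimal],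
        W.analyticRank = 1 →
        (W.j = -32768 ∨ W.j = -884736 ∨ W.j = -884736000 ∨ W.j = -147197952000 ∨
          W.j = -262537412640768000) → Good W 2 → BSDp W 2) ↔
      (∀ d : ℤ, d ≠ 0 → Squarefree d → d % 4 = 1 →
        ∀ (W : WeierstrassCurve ℚ) [W.IsElliptic] [W.IsGloballyMinimal],
          (∃ C : VariableChange ℚ, C • cm11.quadraticTwist (d : ℚ) = W) →
          W.analyticRank = 1 → BSDp W 2) ∧
      (∀ d : ℤ, d ≠ 0 → Squarefree d → d % 4 = 1 →
        ∀ (W : WeierstrassCurve ℚ) [W.IsElliptic] [W.IsGloballyMinimal],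
          (∃ C : VariableChange ℚ, C • cm19.quadraticTwist (d : ℚ) = W) →
          W.analyticRank = 1 → BSDp W 2) ∧
      (∀ d : ℤ, d ≠ 0 → Squarefree d → d % 4 = 1 →
        ∀ (W : WeierstrassCurve ℚ) [W.IsElliptic] [W.IsGloballyMinimal],
          (∃ C : VariableChange ℚ, C • cm43.quadraticTwist (d : ℚ) = W) →
          W.analyticRank = 1 → BSDp W 2) ∧
      (∀ d : ℤ, d ≠ 0 → Squarefree d → d % 4 = 1 →
        ∀ (W : WeierstrassCurve ℚ) [W.IsElliptic] [W.IsGloballyMinimal],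
          (∃ C : VariableChange ℚ, C • cm67.quadraticTwist (d : ℚ) = W) →
          W.analyticRank = 1 → BSDp W 2) ∧
      (∀ d : ℤ, d ≠ 0 → Squarefree d → d % 4 = 1 →
        ∀ (W : WeierstrassCurve ℚ) [W.IsElliptic] [W.IsGloballyMinimal],
          (∃ C : VariableChange ℚ, C • cm163.quadraticTwist (d : ℚ) = W) →
          W.analyticRank = 1 → BSDp W 2) := by
  have e11 := jEq_good_iff_twists cm11 (by rw [j_cm11]; norm_num) (by rw [j_cm11]; norm_num)
    good_two_cm11
  have e19 := jEq_good_iff_twists cm19 (by rw [j_cm19]; norm_num) (by rw [j_cm19]; norm_num)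
    good_two_cm19
  have e43 := jEq_good_iff_twists cm43 (by rw [j_cm43]; norm_num) (by rw [j_cm43]; norm_num)
    good_two_cm43
  have e67 := jEq_good_iff_twists cm67 (by rw [j_cm67]; norm_num) (by rw [j_cm67]; norm_num)
    good_two_cm67
  have e163 := jEq_good_iff_twists cm163 (by rw [j_cm163]; norm_num) (by rw [j_cm163]; norm_num)
    good_two_cm163
  rw [j_cm11] at e11; rw [j_cm19] at e19; rw [j_cm43] at e43; rw [j_cm67] at e67
  rw [j_cm163] at e163
  rw [← e11, ← e19, ← e43, ← e67, ← e163]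
  constructor
  · intro h
    exact ⟨fun W _ _ hr hj => h W hr (Or.inl hj), fun W _ _ hr hj => h W hr (Or.inr (Or.inl hj)),
      fun W _ _ hr hj => h W hr (Or.inr (Or.inr (Or.inl hj))),
      fun W _ _ hr hj => h W hr (Or.inr (Or.inr (Or.inr (Or.inl hj)))),
      fun W _ _ hr hj => h W hr (Or.inr (Or.inr (Or.inr (Or.inr hj))))⟩
  · rintro ⟨h11, h19, h43, h67, h163⟩ W _ _ hr hj
    rcases hj with hj | hj | hj | hj | hj
    · exact h11 W hr hj
    · exact h19 W hr hj
    · exact h43 W hr hj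
    · exact h67 W hr hj
    · exact h163 W hr hj

/-- **THE FIVE ODD HEEGNER FIELDS, CELL INERT-BAD, IN MODEL CURRENCY** — the consequent of the
registered stub `stub_inertOddHeegner_badAtTwo` of item stmt-BirchSwinnertonDyer-20672 ⟺ the
conjunction over the five bases of "`BSD(W,2)` for every globally minimal model of analytic rank one of
a twist of the base by a square-free `d ≡ 2, 3 (mod 4)`" (the additive-at-`2` twists; conductor
`2^{f}p²d'²`). Nothing in print at `2`.
[cite: SilvermanAEC2009, X.5 Prop. 5.4 and Cor. 5.4.1] [cite: SilvermanATAEC1994, App. A §3]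
[cite: BarriosEtAl2025, Thm. 5.1 with the rows R = I₀ of the §5 tables (arXiv:2501.03209 pp. 15–16)] -/
theorem oddHeegnerJ_bad_iff_twists :
    (∀ (W : WeierstrassCurve ℚ) [W.IsElliptic] [W.IsGloballyMinimal],
        W.analyticRank = 1 →
        (W.j = -32768 ∨ W.j = -884736 ∨ W.j = -884736000 ∨ W.j = -147197952000 ∨
          W.j = -262537412640768000) → ¬ Good W 2 → BSDp W 2) ↔
      (∀ d : ℤ, d ≠ 0 → Squarefree d → d % 4 ≠ 1 →
        ∀ (W : WeierstrassCurve ℚ) [W.IsElliptic] [W.IsGloballyMinimal],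
          (∃ C : VariableChange ℚ, C • cm11.quadraticTwist (d : ℚ) = W) →
          W.analyticRank = 1 → BSDp W 2) ∧
      (∀ d : ℤ, d ≠ 0 → Squarefree d → d % 4 ≠ 1 →
        ∀ (W : WeierstrassCurve ℚ) [W.IsElliptic] [W.IsGloballyMinimal],
          (∃ C : VariableChange ℚ, C • cm19.quadraticTwist (d : ℚ) = W) →
          W.analyticRank = 1 → BSDp W 2) ∧
      (∀ d : ℤ, d ≠ 0 → Squarefree d → d % 4 ≠ 1 →
        ∀ (W : WeierstrassCurve ℚ) [W.IsElliptic] [W.IsGloballyMinimal],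
          (∃ C : VariableChange ℚ, C • cm43.quadraticTwist (d : ℚ) = W) →
          W.analyticRank = 1 → BSDp W 2) ∧
      (∀ d : ℤ, d ≠ 0 → Squarefree d → d % 4 ≠ 1 →
        ∀ (W : WeierstrassCurve ℚ) [W.IsElliptic] [W.IsGloballyMinimal],
          (∃ C : VariableChange ℚ, C • cm67.quadraticTwist (d : ℚ) = W) →
          W.analyticRank = 1 → BSDp W 2) ∧
      (∀ d : ℤ, d ≠ 0 → Squarefree d → d % 4 ≠ 1 →
        ∀ (W : WeierstrassCurve ℚ) [W.IsElliptic] [W.IsGloballyMinimal],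
          (∃ C : VariableChange ℚ, C • cm163.quadraticTwist (d : ℚ) = W) →
          W.analyticRank = 1 → BSDp W 2) := by
  have e11 := jEq_bad_iff_twists cm11 (by rw [j_cm11]; norm_num) (by rw [j_cm11]; norm_num)
    good_two_cm11
  have e19 := jEq_bad_iff_twists cm19 (by rw [j_cm19]; norm_num) (by rw [j_cm19]; norm_num)
    good_two_cm19
  have e43 := jEq_bad_iff_twists cm43 (by rw [j_cm43]; norm_num) (by rw [j_cm43]; norm_num)
    good_two_cm43
  have e67 := jEq_bad_iff_twists cm67 (by rw [j_cm67]; norm_num) (by rw [j_cm67]; norm_num)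
    good_two_cm67
  have e163 := jEq_bad_iff_twists cm163 (by rw [j_cm163]; norm_num) (by rw [j_cm163]; norm_num)
    good_two_cm163
  rw [j_cm11] at e11; rw [j_cm19] at e19; rw [j_cm43] at e43; rw [j_cm67] at e67
  rw [j_cm163] at e163
  rw [← e11, ← e19, ← e43, ← e67, ← e163]
  constructor
  · intro h
    exact ⟨fun W _ _ hr hj => h W hr (Or.inl hj), fun W _ _ hr hj => h W hr (Or.inr (Or.inl hj)),
      fun W _ _ hr hj => h W hr (Or.inr (Or.inr (Or.inl hj))),
      fun W _ _ hr hj => h W hr (Or.inr (Or.inr (Or.inr (Or.inl hj)))),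
      fun W _ _ hr hj => h W hr (Or.inr (Or.inr (Or.inr (Or.inr hj))))⟩
  · rintro ⟨h11, h19, h43, h67, h163⟩ W _ _ hr hj
    rcases hj with hj | hj | hj | hj | hj
    · exact h11 W hr hj
    · exact h19 W hr hj
    · exact h43 W hr hj
    · exact h67 W hr hj
    · exact h163 W hr hj

/-! ## §2 `j = 0` (item 20671): INERT-GOOD = `B ≡ 16 (mod 64)` = `y² + y = x³ + a`, INERT-BAD = the rest -/

/-- **`j = 0`, CELL INERT-GOOD, IN MODEL CURRENCY** — the consequent of the registered stub
`stub_inertJZero_goodAtTwo` of item stmt-BirchSwinnertonDyer-20671 (`𝔅_inert → ∀ W, r_an = 1 →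
j(W) = 0 → Good W 2 → BSD(W,2)`) ⟺ "for every `B ∈ ℤ` with `B ≡ 16 (mod 64)`, `BSD(W,2)` for every
globally minimal model `W` of analytic rank one of `y² = x³ + B`". Members: `27a` (`B = −432, 16`),
`243a` (`B = −48`), the cube-sum curves `x³ + y³ = n` with `n` ODD (`B = −432n²`), the Kriz–Li twists
`243a1^{(d)}` with `d ≡ 1 (mod 4)`. [cite: SilvermanAEC2009, X.5 Prop. 5.4 (iii) and VII.5 Prop. 5.1(a)]
[cite: BarriosEtAl2025, Thm. 5.1 with the rows R = I₀ of the §5 tables (arXiv:2501.03209 pp. 15–16)] -/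
theorem jZero_good_iff_sextics :
    (∀ (W : WeierstrassCurve ℚ) [W.IsElliptic] [W.IsGloballyMinimal],
        W.analyticRank = 1 → W.j = 0 → Good W 2 → BSDp W 2) ↔
      (∀ B : ℤ, B % 64 = 16 →
        ∀ (W : WeierstrassCurve ℚ) [W.IsElliptic] [W.IsGloballyMinimal],
          (∃ C : VariableChange ℚ, C • (⟨0, 0, 0, 0, (B : ℚ)⟩ : WeierstrassCurve ℚ) = W) →
          W.analyticRank = 1 → BSDp W 2) := by
  constructor
  · intro h B hB W _ _ hW hr
    obtain ⟨C, hC⟩ := hW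
    have hB0 : B ≠ 0 := by omega
    have hB' : (B : ℚ) ≠ 0 := by exact_mod_cast hB0
    exact h W hr (j_eq_zero_of_smul_sextic hB' hC)
      ((good_two_iff_of_smul_sextic hB0 (by omega) hC).mpr hB)
  · intro h W _ _ hr hj hgood
    obtain ⟨B, hB0, h64, C, hC⟩ := exists_smul_sextic_int_not_dvd_of_j_eq_zero hj
    exact h B ((good_two_iff_of_smul_sextic hB0 h64 hC).mp hgood) W ⟨C, hC⟩ hr

/-- **`j = 0`, CELL INERT-GOOD, IN CREMONA CURRENCY**: the same ⟺ "for every `a ∈ ℤ`, `BSD(W,2)` for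
every globally minimal model `W` of analytic rank one of `y² + y = x³ + a`" (the shape of
`27a1 = ⟨0,0,1,0,−7⟩`, `27a3 = ⟨0,0,1,0,0⟩`, `243a1 = ⟨0,0,1,0,−1⟩`; `y² + y = x³ + a ≅
y² = x³ + 16(4a + 1)`, `smul_cubicA₃_eq_sextic`).
[cite: SilvermanAEC2009, X.5 Prop. 5.4 (iii) and VII.5 Prop. 5.1(a)] -/
theorem jZero_good_iff_cubicA₃Models :
    (∀ (W : WeierstrassCurve ℚ) [W.IsElliptic] [W.IsGloballyMinimal],
        W.analyticRank = 1 → W.j = 0 → Good W 2 → BSDp W 2) ↔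
      (∀ a : ℤ,
        ∀ (W : WeierstrassCurve ℚ) [W.IsElliptic] [W.IsGloballyMinimal],
          (∃ C : VariableChange ℚ, C • (⟨0, 0, 1, 0, (a : ℚ)⟩ : WeierstrassCurve ℚ) = W) →
          W.analyticRank = 1 → BSDp W 2) := by
  rw [jZero_good_iff_sextics]
  constructor
  · intro h a W _ _ hW hr
    obtain ⟨C, hC⟩ := hW
    have e : (((16 * (4 * a + 1) : ℤ)) : ℚ) = 16 * (4 * (a : ℚ) + 1) := by push_cast; ring
    refine h (16 * (4 * a + 1)) (by omega) W
      ⟨C * (⟨Units.mk0 (2⁻¹ : ℚ) (by norm_num), 0, 0, -2⁻¹⟩ : VariableChange ℚ)⁻¹, ?_⟩ hr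
    rw [mul_smul, e, ← smul_cubicA₃_eq_sextic (a : ℚ), inv_smul_smul, hC]
  · intro h B hB W _ _ hW hr
    obtain ⟨C, hC⟩ := hW
    obtain ⟨a, rfl⟩ : ∃ a : ℤ, B = 16 * (4 * a + 1) := ⟨(B - 16) / 64, by omega⟩
    refine h a W ⟨C * ⟨Units.mk0 (2⁻¹ : ℚ) (by norm_num), 0, 0, -2⁻¹⟩, ?_⟩ hr
    rw [mul_smul, smul_cubicA₃_eq_sextic, ← hC]
    congr 1
    push_cast; ring_nf

/-- **`j = 0`, CELL INERT-BAD, IN MODEL CURRENCY** — the consequent of the registered stub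
`stub_inertJZero_badAtTwo` of item stmt-BirchSwinnertonDyer-20671 ⟺ "for every `B ∈ ℤ∖{0}` with
`64 ∤ B` and `B ≢ 16 (mod 64)`, `BSD(W,2)` for every globally minimal model `W` of analytic rank one of
`y² = x³ + B`" (reduced sextic normal form: `2⁶ ∤ B`). Members: `36a1` (`B = 1`) and its twists — the
Shu–Zhai family `36a1^{(−pM)}` (aside 20597) —, the cube-sum curves `x³ + y³ = n` with `n` EVEN
(Satgé / Cai–Shu–Tian twice-primes `2p`, `2p²`), the Kriz–Li twists `243a1^{(d)}` with `d ≡ 2, 3 (mod 4)`.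
[cite: SilvermanAEC2009, X.5 Prop. 5.4 (iii) and VII.5 Prop. 5.1(a)]
[cite: BarriosEtAl2025, Thm. 5.1 with the rows R = I₀ of the §5 tables (arXiv:2501.03209 pp. 15–16)] -/
theorem jZero_bad_iff_sextics :
    (∀ (W : WeierstrassCurve ℚ) [W.IsElliptic] [W.IsGloballyMinimal],
        W.analyticRank = 1 → W.j = 0 → ¬ Good W 2 → BSDp W 2) ↔
      (∀ B : ℤ, B ≠ 0 → ¬ (64 : ℤ) ∣ B → B % 64 ≠ 16 →
        ∀ (W : WeierstrassCurve ℚ) [W.IsElliptic] [W.IsGloballyMinimal],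
          (∃ C : VariableChange ℚ, C • (⟨0, 0, 0, 0, (B : ℚ)⟩ : WeierstrassCurve ℚ) = W) →
          W.analyticRank = 1 → BSDp W 2) := by
  constructor
  · intro h B hB0 h64 hB W _ _ hW hr
    obtain ⟨C, hC⟩ := hW
    have hB' : (B : ℚ) ≠ 0 := by exact_mod_cast hB0
    exact h W hr (j_eq_zero_of_smul_sextic hB' hC)
      (fun hg => hB ((good_two_iff_of_smul_sextic hB0 h64 hC).mp hg))
  · intro h W _ _ hr hj hbad
    obtain ⟨B, hB0, h64, C, hC⟩ := exists_smul_sextic_int_not_dvd_of_j_eq_zero hj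
    exact h B hB0 h64 (fun hB => hbad ((good_two_iff_of_smul_sextic hB0 h64 hC).mpr hB))
      W ⟨C, hC⟩ hr

end Summit.BirchSwinnertonDyer.Rank1Residual.P2.CornerFTwo

end
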